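import Literature.NumberTheory.EllipticCurves.Disegni2017.ChiLineTheoremB
import HarnessLib

/-!
# Disegni 2017, Theorem B at `χ = ψ ∘ N_{K/ℚ}` — the PINNED datum with a POINTWISE pin (proof file)

Topic `Literature/NumberTheory/EllipticCurves`, cluster `Disegni2017` (namespace = path). Companion of
`ChiLineTheoremB.lean` (ty2 g50: the named fact `thmB_chi_quadraticBaseChange` and the repackagings
`exists_datum`, `exists_datum_pinned`, `exists_datum_pinned_of_fixing`). Written by the width seat
`bsd-line-cf2-p1-w8` (g27) of the cell `bsd-print-cf2` on the planner's SUMMON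
`wake/SUMMON-bsd-line-cf2-p1-w8-20260831T031655Z.md`, deliverable (B1) «PIN THEOREM IN, MISSTATED PROP OUT».
THEOREMS ONLY: no `def`, no new named fact, no `sorry`; nothing new is asserted.

## What, and why

`exists_datum_pinned[_of_fixing]` (ty2 g50, §3–§4 of `ChiLineTheoremB.lean`) compose THREE named facts —
`thmB_chi_quadraticBaseChange` (Theorem B at `ψ∘N`), `exists_isCanonicalCyc` (existence of THE canonical
cyclotomic datum) and the GLOBAL pin `isCanonicalCyc_pairing_eq_minusTwist` (for ALL `(V, p, d)`) — into
the shape consumed by the route item `PrintCf2.SplitBadTwoDisegniGZPairOfFacts` of the cell. The global pin,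
as a literal all-`(V, p, d)` Prop, has junk branches (no sigma-squared pair at `p` ⇒ the receptacle's
`padicSigmaSqInvX` is the junk `0`; non-integral models ⇒ no admissible multiples) and is therefore not
provable as stated, while its CONTENT in the consumer's frame (`p = 2`, `d ∈ {−1, 2, −2}`, `V` `ℤ`-integral
with a sigma-squared pair at `2`) is a tree theorem
(`Summit.….Theorems.PrintCf2.DisegniPairTwo.pairing_eq_minusTwist_pairing_of_pair`, Summits side). This file
states the two repackagings with the global hypothesis `(hPin : isCanonicalCyc_pairing_eq_minusTwist)`
REPLACED by the POINTWISE pin for the fixed frame `(W, p, d, H)`: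

  `∀ (DH₀ : PAdicHeightDataK W p H) (Dc : PAdicHeightData (W^{(d)}) p), DH₀.IsCanonicalCyc →
     Dc.IsCanonicalSqMinusTwist → ∀ P = (X, Y) ∈ W^{(d)}(ℚ), ∀ P′ = (x′, y′) ∈ W(H) with x′ = X/d,
     ⟨P′, P′⟩_{DH₀} = ⟨P, P⟩_{Dc}`,

an ordinary hypothesis INSIDE the universally quantified frame (after the binder `hτG : τ ∈ G`), so that
the universal constant `c ∈ ℚ^×` of Theorem B is still quantified BEFORE the frame. Same proofs as ty2's
(the only use of the pin is the last rewrite). The old theorems are the special case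
`hPinAt := hPin W p (d : ℚ) H` (`exists_datum_pinned_of_pinAt_of_pin` records this).

* `thmB_chi_quadraticBaseChange.exists_datum_pinned_of_pinAt` — binder «`G = {1, τ}`»;
* `thmB_chi_quadraticBaseChange.exists_datum_pinned_of_fixing_of_pinAt` — binder «`G` fixes `K`»
  (the restated route item's, referee C′), reduced to the first by
  `Literature.FieldTheory.Galois.QuadraticExtension.subgroup_eq_one_or_eq_of_fixing`;
* `thmB_chi_quadraticBaseChange.exists_datum_pinned_of_pinAt_of_pin` — the global pin implies every
  pointwise pin (so §3–§4 of `ChiLineTheoremB.lean` are corollaries; kept there unchanged).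

BSD is not proved by any of this; Theorem B is not proved here (it stays the hypothesis `hB`).

## References

* [Disegni2017] D. Disegni, *The p-adic Gross–Zagier formula on Shimura curves*, Compos. Math. 153 (2017)
  = arXiv:1510.02114v3: Thm. B = «Theorem 2» (PDF p. 8 L9–18), §1.3.1 (p. 7 L30–50), (4.1.7) (p. 28 L97–101).
* [MazurSteinTate2006] B. Mazur, W. Stein, J. Tate, *Computation of p-adic heights and log convergence*,
  Doc. Math. Extra Vol. Coates (2006), §2.7–2.8 (PDF p. 11).
* [DummitFoote2004] §14.1 Example (1) after Prop. 2 (automorphisms of a quadratic extension).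
* Cell: `wake/SUMMON-bsd-line-cf2-p1-w8-20260831T031655Z.md` (B1); HOME
  `bsd-line-cf2-p1-w8/PIN-THEOREM-27316-w8g26.md` (why the global Prop is misstated).
-/

noncomputable section

open scoped MatrixGroups ModularForm NumberField Classical
open CongruenceSubgroup NumberField IsDedekindDomain WeierstrassCurve
open Literature.NumberTheory.EllipticCurves.ModularForms
open Literature.NumberTheory.Automorphic

namespace Literature.NumberTheory.EllipticCurves.Disegni2017

namespace thmB_chi_quadraticBaseChange

/-! ### §1 Binder «`G = {1, τ}`», pointwise pin -/

/-- **The pinned Disegni datum, POINTWISE pin** — `thmB_chi_quadraticBaseChange` ∧ `exists_isCanonicalCyc`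
COMPOSED, with the pin to the minus-twist receptacle taken as a hypothesis ON THE FRAME `(W, p, d, H)` only
(not the all-`(V, p, d)` named fact): there is a universal `c ∈ ℚ^×` such that for every frame of the fact
with «`W ⊗ H` globally minimal», IF every canonical cyclotomic `H`-datum `DH₀` of `W` agrees with every
canonical Sq-minus-twist `ℚ`-datum `Dc` of `W^{(d)}` on `H`-points above `X/d` (factor one), THEN there is a
datum `DH` on `E(H)` (namely `c • DH₀`) which is `Aut(H/ℚ)`-invariant, satisfies
`ChiLineGrossZagierClauses ι K W H f a (ψ∘N) 𝔭 𝔭′ G χ DH`, and whose value on every `H`-point `P′` of `W`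
with `x(P′) = X/d` is `c ·` the value of any canonical minus-twist datum `Dc` on `P = (X, Y)`.
PROVED from the two facts (same proof as `exists_datum_pinned`, whose global hypothesis is used only
pointwise). [cite: Disegni2017, Theorem B (arXiv v3 PDF p. 8 L9–18), (4.1.7) (p. 28 L97–101)]
[cite: MazurSteinTate2006, §2.7–2.8 (PDF p. 11)] -/
theorem exists_datum_pinned_of_pinAt (hB : thmB_chi_quadraticBaseChange) (hE : exists_isCanonicalCyc)
    {p : ℕ} [Fact p.Prime] :
    ∃ c : ℚ, c ≠ 0 ∧
      ∀ (ι : PadicAlgCl p ≃+* ℂ) (K : Type) [Field K] [NumberField K] [IsGalois ℚ K]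
        (𝔭 𝔭' : HeightOneSpectrum (𝓞 K)) (W : WeierstrassCurve ℚ) [W.IsElliptic] [W.IsGloballyMinimal]
        {N : ℕ} [NeZero N] (f : CuspForm (Gamma0 N) 2) {m : ℕ} [NeZero m] (ψ : DirichletCharacter ℂ m)
        (d : ℤ) [(W.quadraticTwist (d : ℚ)).IsElliptic] (H : Type) [Field H] [NumberField H] [Algebra K H]
        [(W.baseChange H).IsGloballyMinimal]
        (t : H) (τ : H ≃ₐ[ℚ] H) (G : Subgroup (H ≃ₐ[ℚ] H)) (χ : G →* ℂˣ) (hτG : τ ∈ G),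
        (∀ (DH₀ : PAdicHeightDataK W p H) (Dc : PAdicHeightData (W.quadraticTwist (d : ℚ)) p),
            DH₀.IsCanonicalCyc → Dc.IsCanonicalSqMinusTwist →
              ∀ {X Y : ℚ} (hP : (W.quadraticTwist (d : ℚ)).toAffine.Nonsingular X Y) {x' y' : H}
                (hP' : (W.baseChange H).toAffine.Nonsingular x' y'),
                x' = algebraMap ℚ H (X / (d : ℚ)) →
                  DH₀.pairing (.some x' y' hP') (.some x' y' hP') =
                    Dc.pairing (.some X Y hP) (.some X Y hP)) →
        IsImaginaryQuadratic K → ((Ideal.span {(p : ℤ)}).primesOver (𝓞 K)).ncard = 2 →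
        ((p : ℕ) : 𝓞 K) ∈ 𝔭.asIdeal → ((p : ℕ) : 𝓞 K) ∈ 𝔭'.asIdeal → 𝔭 ≠ 𝔭' →
        IsNewformOf W f → IsOrdinaryAt W p →
        (∀ ℓ : ℕ, ℓ.Prime → ℓ ≠ 2 → ¬ ℓ ∣ m → ψ ℓ = (jacobiSym d ℓ : ℂ)) →
        (∀ ℓ : ℕ, ℓ.Prime → ℓ ∣ m → ¬ ℓ ^ 2 ∣ N) →
        IsNotExceptionalAt (p := p) (ι (((unitRoot W p : ℚ_[p]) : PadicAlgCl p))) (baseChangeDirichlet K ψ) 𝔭 →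
        IsNotExceptionalAt (p := p) (ι (((unitRoot W p : ℚ_[p]) : PadicAlgCl p))) (baseChangeDirichlet K ψ) 𝔭' →
        (∀ Λ : ℂ → ℂ, Differentiable ℂ Λ →
          (∀ s : ℂ, 2 < s.re → Λ s = rankinSelbergEulerProductHecke f (baseChangeDirichlet K ψ) s) →
            Λ 1 = 0 ∧ deriv Λ 1 ≠ 0) →
        Module.finrank K H = 2 → t ^ 2 = algebraMap ℚ H (d : ℚ) → t ∉ Set.range (algebraMap K H) →
        (∀ a : K, τ (algebraMap K H a) = algebraMap K H a) → τ t = -t →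
        (∀ σ : G, (σ : H ≃ₐ[ℚ] H) = 1 ∨ (σ : H ≃ₐ[ℚ] H) = τ) → ((χ ⟨τ, hτG⟩ : ℂˣ) : ℂ) = -1 →
        ∃ DH : PAdicHeightDataK W p H,
          (∀ (σ : H ≃ₐ[ℚ] H) (a b : (W.baseChange H).toAffine.Point),
              DH.pairing (pointGalHom W H σ a) (pointGalHom W H σ b) = DH.pairing a b) ∧
          ChiLineGrossZagierClauses ι K W H f (ι (((unitRoot W p : ℚ_[p]) : PadicAlgCl p)))
            (baseChangeDirichlet K ψ) 𝔭 𝔭' G χ DH ∧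
          ∀ (Dc : PAdicHeightData (W.quadraticTwist (d : ℚ)) p), Dc.IsCanonicalSqMinusTwist →
            ∀ {X Y : ℚ} (hP : (W.quadraticTwist (d : ℚ)).toAffine.Nonsingular X Y) {x' y' : H}
              (hP' : (W.baseChange H).toAffine.Nonsingular x' y'),
              x' = algebraMap ℚ H (X / (d : ℚ)) →
                DH.pairing (.some x' y' hP') (.some x' y' hP') =
                  (c : ℚ_[p]) * Dc.pairing (.some X Y hP) (.some X Y hP) := by
  obtain ⟨c, hc, h⟩ := hB (p := p)
  refine ⟨c, hc, ?_⟩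
  intro ι K _ _ _ 𝔭 𝔭' W _ _ N _ f m _ ψ d _ H _ _ _ _ t τ G χ hτG hPinAt hK hsplit h𝔭 h𝔭' hne hf hord
    hψ hmN hexc hexc' hΛ hKH ht2 htK hτK hτt hG hχ
  obtain ⟨DH₀, hcan, hinv⟩ := hE W p H hord.1 hord.2
  refine ⟨DH₀.smul c, fun σ a b => PAdicHeightDataK.smul_pairing_invariant c (hinv σ) a b,
    h ι K 𝔭 𝔭' W f ψ d H t τ G χ hτG hK hsplit h𝔭 h𝔭' hne hf hord hψ hmN hexc hexc' hΛ hKH ht2 htK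
      hτK hτt hG hχ DH₀ hcan, ?_⟩
  intro Dc hDc X Y hP x' y' hP' hx'
  rw [PAdicHeightDataK.smul_pairing, hPinAt DH₀ Dc hcan hDc hP hP' hx']

/-! ### §2 Binder «`G` fixes `K`», pointwise pin -/

/-- **The pinned Disegni datum, `K`-FIXING form of the Galois binder, POINTWISE pin**: as
`exists_datum_pinned_of_pinAt`, but the hypothesis on `G ≤ Aut(H/ℚ)` is «every `σ ∈ G` fixes `K`
pointwise» (with `τ ∈ G`), which for the quadratic `H = K(t)` is EQUIVALENT to «every `σ ∈ G` is `1` or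
`τ`» (`Literature.FieldTheory.Galois.QuadraticExtension.subgroup_eq_one_or_eq_of_fixing`). This is the
binder of the route item `PrintCf2.SplitBadTwoDisegniGZPairOfFacts` as restated (cell referee C′), with the
pin as a hypothesis on the frame `(W, p, d, H)` only. PROVED from the two named facts.
[cite: Disegni2017, Theorem B (arXiv v3 PDF p. 8 L9–18)] [cite: DummitFoote2004, §14.1 Example (1) after Prop. 2] -/
theorem exists_datum_pinned_of_fixing_of_pinAt (hB : thmB_chi_quadraticBaseChange)
    (hE : exists_isCanonicalCyc) {p : ℕ} [Fact p.Prime] :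
    ∃ c : ℚ, c ≠ 0 ∧
      ∀ (ι : PadicAlgCl p ≃+* ℂ) (K : Type) [Field K] [NumberField K] [IsGalois ℚ K]
        (𝔭 𝔭' : HeightOneSpectrum (𝓞 K)) (W : WeierstrassCurve ℚ) [W.IsElliptic] [W.IsGloballyMinimal]
        {N : ℕ} [NeZero N] (f : CuspForm (Gamma0 N) 2) {m : ℕ} [NeZero m] (ψ : DirichletCharacter ℂ m)
        (d : ℤ) [(W.quadraticTwist (d : ℚ)).IsElliptic] (H : Type) [Field H] [NumberField H] [Algebra K H]
        [(W.baseChange H).IsGloballyMinimal]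
        (t : H) (τ : H ≃ₐ[ℚ] H) (G : Subgroup (H ≃ₐ[ℚ] H)) (χ : G →* ℂˣ) (hτG : τ ∈ G),
        (∀ (DH₀ : PAdicHeightDataK W p H) (Dc : PAdicHeightData (W.quadraticTwist (d : ℚ)) p),
            DH₀.IsCanonicalCyc → Dc.IsCanonicalSqMinusTwist →
              ∀ {X Y : ℚ} (hP : (W.quadraticTwist (d : ℚ)).toAffine.Nonsingular X Y) {x' y' : H}
                (hP' : (W.baseChange H).toAffine.Nonsingular x' y'),
                x' = algebraMap ℚ H (X / (d : ℚ)) →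
                  DH₀.pairing (.some x' y' hP') (.some x' y' hP') =
                    Dc.pairing (.some X Y hP) (.some X Y hP)) →
        IsImaginaryQuadratic K → ((Ideal.span {(p : ℤ)}).primesOver (𝓞 K)).ncard = 2 →
        ((p : ℕ) : 𝓞 K) ∈ 𝔭.asIdeal → ((p : ℕ) : 𝓞 K) ∈ 𝔭'.asIdeal → 𝔭 ≠ 𝔭' →
        IsNewformOf W f → IsOrdinaryAt W p →
        (∀ ℓ : ℕ, ℓ.Prime → ℓ ≠ 2 → ¬ ℓ ∣ m → ψ ℓ = (jacobiSym d ℓ : ℂ)) →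
        (∀ ℓ : ℕ, ℓ.Prime → ℓ ∣ m → ¬ ℓ ^ 2 ∣ N) →
        IsNotExceptionalAt (p := p) (ι (((unitRoot W p : ℚ_[p]) : PadicAlgCl p))) (baseChangeDirichlet K ψ) 𝔭 →
        IsNotExceptionalAt (p := p) (ι (((unitRoot W p : ℚ_[p]) : PadicAlgCl p))) (baseChangeDirichlet K ψ) 𝔭' →
        (∀ Λ : ℂ → ℂ, Differentiable ℂ Λ →
          (∀ s : ℂ, 2 < s.re → Λ s = rankinSelbergEulerProductHecke f (baseChangeDirichlet K ψ) s) →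
            Λ 1 = 0 ∧ deriv Λ 1 ≠ 0) →
        Module.finrank K H = 2 → t ^ 2 = algebraMap ℚ H (d : ℚ) → t ∉ Set.range (algebraMap K H) →
        (∀ a : K, τ (algebraMap K H a) = algebraMap K H a) → τ t = -t →
        (∀ (σ : G) (a : K), (σ : H ≃ₐ[ℚ] H) (algebraMap K H a) = algebraMap K H a) →
        ((χ ⟨τ, hτG⟩ : ℂˣ) : ℂ) = -1 →
        ∃ DH : PAdicHeightDataK W p H,
          (∀ (σ : H ≃ₐ[ℚ] H) (a b : (W.baseChange H).toAffine.Point),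
              DH.pairing (pointGalHom W H σ a) (pointGalHom W H σ b) = DH.pairing a b) ∧
          ChiLineGrossZagierClauses ι K W H f (ι (((unitRoot W p : ℚ_[p]) : PadicAlgCl p)))
            (baseChangeDirichlet K ψ) 𝔭 𝔭' G χ DH ∧
          ∀ (Dc : PAdicHeightData (W.quadraticTwist (d : ℚ)) p), Dc.IsCanonicalSqMinusTwist →
            ∀ {X Y : ℚ} (hP : (W.quadraticTwist (d : ℚ)).toAffine.Nonsingular X Y) {x' y' : H}
              (hP' : (W.baseChange H).toAffine.Nonsingular x' y'),
              x' = algebraMap ℚ H (X / (d : ℚ)) →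
                DH.pairing (.some x' y' hP') (.some x' y' hP') =
                  (c : ℚ_[p]) * Dc.pairing (.some X Y hP) (.some X Y hP) := by
  obtain ⟨c, hc, h⟩ := exists_datum_pinned_of_pinAt hB hE (p := p)
  refine ⟨c, hc, ?_⟩
  intro ι K _ _ _ 𝔭 𝔭' W _ _ N _ f m _ ψ d _ H _ _ _ _ t τ G χ hτG hPinAt hK hsplit h𝔭 h𝔭' hne hf hord
    hψ hmN hexc hexc' hΛ hKH ht2 htK hτK hτt hGK hχ
  -- `t² ∈ K`: `algebraMap ℚ H d = algebraMap K H d` for the integer `d`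
  have hte : t ^ 2 = algebraMap K H (d : K) := by rw [ht2, map_intCast, map_intCast]
  have hG : ∀ σ : G, (σ : H ≃ₐ[ℚ] H) = 1 ∨ (σ : H ≃ₐ[ℚ] H) = τ :=
    Literature.FieldTheory.Galois.QuadraticExtension.subgroup_eq_one_or_eq_of_fixing hKH htK hte hτK
      hτt hGK
  exact h ι K 𝔭 𝔭' W f ψ d H t τ G χ hτG hPinAt hK hsplit h𝔭 h𝔭' hne hf hord hψ hmN hexc hexc' hΛ hKH
    ht2 htK hτK hτt hG hχ

/-! ### §3 The global named fact implies every pointwise pin -/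

/-- **The global pin implies the pointwise pin on every frame** (so `exists_datum_pinned` and
`exists_datum_pinned_of_fixing` of `ChiLineTheoremB.lean` are the corollaries
`hPinAt := hPin W p (d : ℚ) H` of §1–§2). Trivial specialisation; recorded for the consumer's bookkeeping.
[cite: MazurSteinTate2006, §2.8 (PDF p. 11 L33–47)] -/
theorem pinAt_of_pin (hPin : isCanonicalCyc_pairing_eq_minusTwist) (W : WeierstrassCurve ℚ) [W.IsElliptic]
    (p : ℕ) [Fact p.Prime] (d : ℤ) [(W.quadraticTwist (d : ℚ)).IsElliptic] (H : Type) [Field H]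
    [NumberField H] :
    ∀ (DH₀ : PAdicHeightDataK W p H) (Dc : PAdicHeightData (W.quadraticTwist (d : ℚ)) p),
      DH₀.IsCanonicalCyc → Dc.IsCanonicalSqMinusTwist →
        ∀ {X Y : ℚ} (hP : (W.quadraticTwist (d : ℚ)).toAffine.Nonsingular X Y) {x' y' : H}
          (hP' : (W.baseChange H).toAffine.Nonsingular x' y'),
          x' = algebraMap ℚ H (X / (d : ℚ)) →
            DH₀.pairing (.some x' y' hP') (.some x' y' hP') = Dc.pairing (.some X Y hP) (.some X Y hP) :=
  fun DH₀ Dc hcan hDc _ _ hP _ _ hP' hx' => hPin W p (d : ℚ) H DH₀ Dc hcan hDc hP hP' hx'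

end thmB_chi_quadraticBaseChange

end Literature.NumberTheory.EllipticCurves.Disegni2017

end
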